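import Summits.NavierStokesRegularity.NavierStokesRegularity.Theses.AxisymmetricExtremality
import Summits.NavierStokesRegularity.NavierStokesRegularity.Theorems.AxisymmetricSwirlRegularity
import Summits.NavierStokesRegularity.NavierStokesRegularity.Theorems.AxisymmetricExtremalityAxisymmetricKatoGlobalNoSwirlStratum

/-!
# Strategist s19-g13 — typed companion of STRATEGY-CENSUS-s19-g13.md (crux `AxisymmetricKatoGlobal`)

Nothing here is a registered line: these are the census's typed attempts.
* `NoAxisymMinimalBlowupDatum` (W1) — the strictly-weaker threshold instance of the crux that the
  route's `closes` actually consumes (`closes_of_w1`), and `w1_of_crux`.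
* `AxisymClayGlobal` / `ClassTransfer` / `crux_of_De` — the class split D-e (ns.S25 ∧ transfer ⇒ crux),
  modus ponens; recorded to show the seam is trivial and where the content sits.
* W1′ = `NoO2MinimalBlowupDatum` — the O(2) (dihedral) weakening: PROVED here
  (`noO2MinimalBlowupDatum_holds`) from the landed swirl-free stratum
  `axisymmetricKatoGlobal_noSwirl_stratum` and the elementary `hasNoSwirl_of_O2`
  (axisymmetric + one reflection ⇒ swirl-free); `closes_via_O2` shows the route's deciding theorem
  re-glued on the dihedral analogues `MinimalDatumDihedralFold`, `DihedralToO2` no longer consumes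
  the crux at all (credit for the dihedral idea: crux card `Ideas/dihedral-smith-bypass.md`; this file
  only certifies the AKG-side input and the glue). A ROUTE-level matter (tenure), recorded for the census.
-/

namespace Summit.NavierStokesRegularity.NavierStokesRegularity.Cruxes.AxisymmetricKatoGlobal.StrategistS19g13

open Summit.NavierStokesRegularity.NavierStokesRegularity.Theses.AxisymmetricExtremality

/-- W1 (weaker intermediate): there is no axisymmetric Rusin–Šverák minimal blow-up datum.
This is exactly the instance of `AxisymmetricKatoGlobal` used by `closes`. -/
def NoAxisymMinimalBlowupDatum : Prop :=
  ∀ ν : ℝ, 0 < ν → ∀ (u₀ : EuclideanSpace ℝ (Fin 3) → EuclideanSpace ℝ (Fin 3))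
    (g : Literature.Analysis.FunctionSpaces.HomSobolev (EuclideanSpace ℝ (Fin 3))
      (EuclideanSpace ℂ (Fin 3)) (1 / 2 : ℝ)),
    Literature.Analysis.FluidPDE.IsMinimalBlowupDatum ν u₀ g →
    (∀ (θ : ℝ) (x : EuclideanSpace ℝ (Fin 3)),
      u₀ (WithLp.toLp 2 ![Real.cos θ * x 0 - Real.sin θ * x 1, Real.sin θ * x 0 + Real.cos θ * x 1, x 2])
        = WithLp.toLp 2 ![Real.cos θ * u₀ x 0 - Real.sin θ * u₀ x 1,
            Real.sin θ * u₀ x 0 + Real.cos θ * u₀ x 1, u₀ x 2]) → False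

/-- The crux implies W1 (W1 is weaker). -/
theorem w1_of_crux (h : AxisymmetricKatoGlobal) : NoAxisymMinimalBlowupDatum := by
  intro ν hν u₀ g hmin hax
  obtain ⟨hL3, hrep, hdiv, -, hnot⟩ := hmin
  exact hnot (h ν hν u₀ g hL3 hrep hdiv hax)

/-- W1 already suffices for the route's deciding theorem (same proof as `closes`). -/
theorem closes_of_w1 (h₂ : MinimalDatumPFold) (h₄ : PFoldToAxisymmetric)
    (hW : NoAxisymMinimalBlowupDatum) : _root_.NavierStokesRegularity := by
  show Literature.NS.NavierStokesExistenceSmoothR3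
  intro ν hν u₀ hsm hdiv hdec
  by_contra hno
  obtain ⟨u₁, g, hmin, hax⟩ := h₄ ν hν (h₂ ν hν ⟨u₀, hsm, hdiv, hdec, hno⟩)
  exact hW ν hν u₁ g hmin hax

/-- Since `PFoldToAxisymmetric` is proved, the route's open content is `MinimalDatumPFold ∧ W1`. -/
theorem closes_of_w1' (h₄ : PFoldToAxisymmetric) :
    MinimalDatumPFold → NoAxisymMinimalBlowupDatum → _root_.NavierStokesRegularity :=
  fun h₂ hW => closes_of_w1 h₂ h₄ hW

/-- D-e piece 1: the named open problem ns.S25 (canonical conjecture leaf, Clay class, axisymmetric). -/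
abbrev AxisymClayGlobal : Prop :=
  Summit.NavierStokesRegularity.NavierStokesRegularity.AxisymmetricSwirlRegularity

/-- D-e piece 2: class transfer from the Clay (Schwartz) class to the critical Kato class
`L³ ∩ Ḣ^{1/2}`, weakly div-free, axisymmetric — open even without symmetry (census § Decomposition). -/
def ClassTransfer : Prop := AxisymClayGlobal → AxisymmetricKatoGlobal

/-- D-e assembly: modus ponens (trivial seam; all content in the two pieces). -/
theorem crux_of_De (h₁ : AxisymClayGlobal) (h₂ : ClassTransfer) : AxisymmetricKatoGlobal := h₂ h₁


section O2

open Literature.Analysis.FluidPDE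
open Summit.NavierStokesRegularity.NavierStokesRegularity.Theorems.AxisymmetricKatoGlobal.NoSwirlStratum

/-- Reflection across the plane `x₁ = 0` (an element of `O(2) ∖ SO(2)` on the horizontal plane). -/
def reflY (x : EuclideanSpace ℝ (Fin 3)) : EuclideanSpace ℝ (Fin 3) :=
  WithLp.toLp 2 ![x 0, -(x 1), x 2]

@[simp] theorem reflY_apply_zero (x : EuclideanSpace ℝ (Fin 3)) : reflY x 0 = x 0 := rfl
@[simp] theorem reflY_apply_one (x : EuclideanSpace ℝ (Fin 3)) : reflY x 1 = -(x 1) := rfl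
@[simp] theorem reflY_apply_two (x : EuclideanSpace ℝ (Fin 3)) : reflY x 2 = x 2 := rfl

/-- Reflection-equivariance `u (σ x) = σ (u x)`. Together with `IsAxisymmetric` this is
`O(2)`-equivariance. -/
def IsReflEquivariant (u₀ : EuclideanSpace ℝ (Fin 3) → EuclideanSpace ℝ (Fin 3)) : Prop :=
  ∀ x, u₀ (reflY x) = reflY (u₀ x)

private theorem exists_cos_sin_eq {c s : ℝ} (h : c ^ 2 + s ^ 2 = 1) :
    ∃ θ : ℝ, Real.cos θ = c ∧ Real.sin θ = s := by
  refine ⟨Complex.arg ⟨c, s⟩, ?_, ?_⟩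
  all_goals
    have hz : ‖(⟨c, s⟩ : ℂ)‖ = 1 := by
      rw [Complex.norm_eq_sqrt_sq_add_sq]
      change Real.sqrt (c ^ 2 + s ^ 2) = 1
      rw [h, Real.sqrt_one]
    have hz0 : (⟨c, s⟩ : ℂ) ≠ 0 := by
      intro h0
      rw [h0, norm_zero] at hz
      exact zero_ne_one hz
  · rw [Complex.cos_arg hz0, hz, div_one]
  · rw [Complex.sin_arg, hz, div_one]

/-- The swirl `Γ = x₀u₁ − x₁u₀` of an axisymmetric field is rotation invariant. -/
theorem swirl_rotZ {u₀ : EuclideanSpace ℝ (Fin 3) → EuclideanSpace ℝ (Fin 3)}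
    (hax : IsAxisymmetric u₀) (θ : ℝ) (x : EuclideanSpace ℝ (Fin 3)) :
    swirl u₀ (rotZ θ x) = swirl u₀ x := by
  unfold swirl
  rw [hax θ x]
  simp only [rotZ_apply_zero, rotZ_apply_one]
  linear_combination (x 0 * u₀ x 1 - x 1 * u₀ x 0) * Real.cos_sq_add_sin_sq θ

/-- The swirl is odd under the reflection for a reflection-equivariant field. -/
theorem swirl_reflY {u₀ : EuclideanSpace ℝ (Fin 3) → EuclideanSpace ℝ (Fin 3)}
    (hrefl : IsReflEquivariant u₀) (x : EuclideanSpace ℝ (Fin 3)) :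
    swirl u₀ (reflY x) = -swirl u₀ x := by
  unfold swirl
  rw [hrefl x]
  simp only [reflY_apply_zero, reflY_apply_one]
  ring

/-- **O(2)-equivariant fields are swirl-free**: axisymmetric + equivariant under one reflection
containing the axis ⇒ `Γ ≡ 0` (the reflection of the point `x` is also a rotation of `x`). -/
theorem hasNoSwirl_of_O2 {u₀ : EuclideanSpace ℝ (Fin 3) → EuclideanSpace ℝ (Fin 3)}
    (hax : IsAxisymmetric u₀) (hrefl : IsReflEquivariant u₀) : HasNoSwirl u₀ := by
  intro x
  by_cases h0 : x 0 ^ 2 + x 1 ^ 2 = 0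
  · have hx0 : x 0 = 0 := by nlinarith [sq_nonneg (x 0), sq_nonneg (x 1)]
    have hx1 : x 1 = 0 := by nlinarith [sq_nonneg (x 0), sq_nonneg (x 1)]
    simp [swirl, hx0, hx1]
  · obtain ⟨θ, hc, hs⟩ := exists_cos_sin_eq (c := (x 0 ^ 2 - x 1 ^ 2) / (x 0 ^ 2 + x 1 ^ 2))
      (s := -(2 * x 0 * x 1) / (x 0 ^ 2 + x 1 ^ 2)) (by field_simp; ring)
    have hrot : rotZ θ x = reflY x := by
      ext i
      fin_cases i
      · simp [hc, hs]
        field_simp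
        ring
      · simp [hc, hs]
        field_simp
        ring
      · simp [reflY]
    have h1 := swirl_rotZ hax θ x
    rw [hrot, swirl_reflY hrefl] at h1
    linarith

/-- W1′ (the O(2) weakening of the crux's threshold instance): no Rusin–Šverák minimal blow-up
datum is axisymmetric and reflection-equivariant. -/
def NoO2MinimalBlowupDatum : Prop :=
  ∀ ν : ℝ, 0 < ν → ∀ (u₀ : EuclideanSpace ℝ (Fin 3) → EuclideanSpace ℝ (Fin 3))
    (g : Literature.Analysis.FunctionSpaces.HomSobolev (EuclideanSpace ℝ (Fin 3))
      (EuclideanSpace ℂ (Fin 3)) (1 / 2 : ℝ)),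
    IsMinimalBlowupDatum ν u₀ g → IsAxisymmetric u₀ → IsReflEquivariant u₀ → False

/-- W1 ⇒ W1′ (W1′ is weaker still). -/
theorem noO2_of_w1 (h : NoAxisymMinimalBlowupDatum) : NoO2MinimalBlowupDatum :=
  fun ν hν u₀ g hmin hax _ => h ν hν u₀ g hmin (fun θ x => hax θ x)

/-- **W1′ is a theorem**: by `hasNoSwirl_of_O2` and the LANDED swirl-free stratum of the crux
(`axisymmetricKatoGlobal_noSwirl_stratum`), an O(2)-equivariant minimal blow-up datum would have a
global Kato solution, contradicting its minimality clause. -/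
theorem noO2MinimalBlowupDatum_holds : NoO2MinimalBlowupDatum := by
  intro ν hν u₀ g hmin hax hrefl
  obtain ⟨hL3, -, hdiv, -, hnot⟩ := hmin
  exact hnot (axisymmetricKatoGlobal_noSwirl_stratum ν hν u₀ hL3 hdiv (fun θ x => hax θ x)
    (hasNoSwirl_of_O2 hax hrefl))

/-- Clay (A) fails at viscosity `ν` — verbatim the antecedent of `MinimalDatumPFold`. -/
def ClayFailsAt (ν : ℝ) : Prop :=
  ∃ v₀ : EuclideanSpace ℝ (Fin 3) → EuclideanSpace ℝ (Fin 3), ContDiff ℝ (⊤ : ℕ∞) v₀ ∧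
    Literature.Analysis.FluidPDE.NSWave0.IsDivFree v₀ ∧
    Literature.Analysis.FluidPDE.HasRapidSpatialDecay v₀ ∧
    ¬ ∃ (u : ℝ → EuclideanSpace ℝ (Fin 3) → EuclideanSpace ℝ (Fin 3))
        (p : ℝ → EuclideanSpace ℝ (Fin 3) → ℝ),
        Literature.Analysis.FluidPDE.IsSmoothOnHalfSpace u ∧
        Literature.Analysis.FluidPDE.IsSmoothOnHalfSpace p ∧
        Literature.Analysis.FluidPDE.IsNavierStokesSolution ν 0 v₀ u p ∧
        Literature.Analysis.FluidPDE.HasBoundedEnergy u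

/-- `p`-fold rotational symmetry about the axis (as in `MinimalDatumPFold`, via `rotZ`). -/
def IsPFold (p : ℕ) (u₀ : EuclideanSpace ℝ (Fin 3) → EuclideanSpace ℝ (Fin 3)) : Prop :=
  ∀ x, u₀ (rotZ (2 * Real.pi / p) x) = rotZ (2 * Real.pi / p) (u₀ x)

/-- Dihedral analogue of the crux `MinimalDatumPFold` (Smith theory for the dihedral groups,
e.g. the 2-groups `D_{2^k}`, on the minimal-data moduli): `D_p`-symmetric minimal blow-up data for
unboundedly many `p`. OPEN — the same bet as `MinimalDatumPFold`. -/
def MinimalDatumDihedralFold : Prop :=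
  ∀ ν : ℝ, 0 < ν → ClayFailsAt ν → ∀ N : ℕ, ∃ p : ℕ, N ≤ p ∧ 2 ≤ p ∧
    ∃ (u₀ : EuclideanSpace ℝ (Fin 3) → EuclideanSpace ℝ (Fin 3))
      (g : Literature.Analysis.FunctionSpaces.HomSobolev (EuclideanSpace ℝ (Fin 3))
        (EuclideanSpace ℂ (Fin 3)) (1 / 2 : ℝ)),
      IsMinimalBlowupDatum ν u₀ g ∧ IsPFold p u₀ ∧ IsReflEquivariant u₀

/-- Dihedral analogue of the PROVED `PFoldToAxisymmetric`: the reflection is carried through the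
Rusin–Šverák `Ḣ^{1/2}`-limit (closed condition) — provable by the landed proof plus one line. -/
def DihedralToO2 : Prop :=
  ∀ ν : ℝ, 0 < ν → (∀ N : ℕ, ∃ p : ℕ, N ≤ p ∧ 2 ≤ p ∧
    ∃ (u₀ : EuclideanSpace ℝ (Fin 3) → EuclideanSpace ℝ (Fin 3))
      (g : Literature.Analysis.FunctionSpaces.HomSobolev (EuclideanSpace ℝ (Fin 3))
        (EuclideanSpace ℂ (Fin 3)) (1 / 2 : ℝ)),
      IsMinimalBlowupDatum ν u₀ g ∧ IsPFold p u₀ ∧ IsReflEquivariant u₀) →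
    ∃ (u₀ : EuclideanSpace ℝ (Fin 3) → EuclideanSpace ℝ (Fin 3))
      (g : Literature.Analysis.FunctionSpaces.HomSobolev (EuclideanSpace ℝ (Fin 3))
        (EuclideanSpace ℂ (Fin 3)) (1 / 2 : ℝ)),
      IsMinimalBlowupDatum ν u₀ g ∧ IsAxisymmetric u₀ ∧ IsReflEquivariant u₀

/-- **The O(2) re-glue decides the summit WITHOUT the crux `AxisymmetricKatoGlobal`**
(kernel-checked; the AKG-side input is the theorem `noO2MinimalBlowupDatum_holds`). -/
theorem closes_via_O2 (hD : MinimalDatumDihedralFold) (hO : DihedralToO2) :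
    _root_.NavierStokesRegularity := by
  show Literature.NS.NavierStokesExistenceSmoothR3
  intro ν hν u₀ hsm hdiv hdec
  by_contra hno
  obtain ⟨u₁, g, hmin, hax, hrefl⟩ := hO ν hν (hD ν hν ⟨u₀, hsm, hdiv, hdec, hno⟩)
  exact noO2MinimalBlowupDatum_holds ν hν u₁ g hmin hax hrefl

end O2

end Summit.NavierStokesRegularity.NavierStokesRegularity.Cruxes.AxisymmetricKatoGlobal.StrategistS19g13
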